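import Summits.Ventures.PercRepro.Parallel
import Summits.Ventures.PercRepro.Series

/-!
# PercRepro — the parallel / subdivision identities of the full-cube class sums (typer-2, gen 4)

p1's `P1-census-g3.md` §A (ASSIGNMENTS v26 typer-2 (a)): for the ORDERED class sum `CS(G)` of a
kernel on the full cube of a marked multigraph (all edges free, ordered antipodal pairs `(ρ, ρᶜ)`),
  `CS(G + e′) = CS(G) + 2·CS(G/e)`   (`e′ ∥ e`)      and      `CS(G sub e) = CS(G) + 2·CS(G − e)`.
Here deletion and contraction are encoded on the SAME edge type by forcing bits in both copies:
`cubeSumDel K c e′` (`e′` closed in both copies = the minor `G − e′`), `cubeSumDelCon K c e′ e`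
(`e′` closed, `e` open in both = `G/e − e′`), `cubeSumDel2 K c e₁ e₂` (both closed). The identities
hold for ANY kernel `K` and any row map `c` that only sees connectivity:

* `cubeSum_parallel` — under `c (ω[e′ := b]) = c ω` when `e` is open and symmetrically;
* `cubeSum_series` — under `c_G ρ = c_{G′} (serConfig e₁ e₂ ρ)` (`Series.lean`);
* the C-011 instances **`cubeSumC011_parallel`**, **`IsSeries.cubeSumC011`** for the row map
  `ρ ↦ row4 (Π(ρ))` and the kernel `phiPlusKernel` (`CS = g − b − n`, `cubeSumC011_eq`).
With them «Lemma B⁺ on all simple graphs on ≤ N vertices ⇒ on all multigraphs on ≤ N vertices» is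
an induction on the number of edges (p1's §A).
-/

namespace PercRepro

open Finset

section Compl

variable {E : Type*}

/-- The complement of a configuration, pointwise. -/
theorem compl_apply_bool (ρ : Config E) (x : E) : ρᶜ x = !ρ x := by
  rw [Pi.compl_apply]
  cases ρ x <;> rfl

/-- The complement at an open coordinate is closed. -/
theorem compl_apply_of_eq_true {ρ : Config E} {e : E} (h : ρ e = true) : ρᶜ e = false := by
  rw [compl_apply_bool, h]
  rfl

/-- The complement at a closed coordinate is open. -/
theorem compl_apply_of_eq_false {ρ : Config E} {e : E} (h : ρ e = false) : ρᶜ e = true := by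
  rw [compl_apply_bool, h]
  rfl

variable [DecidableEq E]

/-- The complement of an update. -/
theorem compl_update (ρ : Config E) (e : E) (b : Bool) :
    (Function.update ρ e b)ᶜ = Function.update ρᶜ e (!b) := by
  funext x
  by_cases hx : x = e
  · subst hx
    rw [compl_apply_bool, Function.update_self, Function.update_self]
  · rw [compl_apply_bool, Function.update_of_ne hx, Function.update_of_ne hx, compl_apply_bool]

/-- Updating a coordinate to its own value. -/
theorem update_eq_self_of_eq {ρ : Config E} {e : E} {b : Bool} (h : ρ e = b) :
    Function.update ρ e b = ρ :=
  Function.update_eq_self_iff.mpr h.symm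

/-- Both edges open: `serConfig` closes `e₂`. -/
theorem serConfig_of_true_true {e₁ e₂ : E} (hne : e₁ ≠ e₂) {ρ : Config E} (h₁ : ρ e₁ = true)
    (h₂ : ρ e₂ = true) : serConfig e₁ e₂ ρ = Function.update ρ e₂ false := by
  funext x
  by_cases hx₁ : x = e₁
  · subst hx₁
    rw [serConfig_apply_fst, h₁, h₂, Function.update_of_ne hne, h₁]
    rfl
  by_cases hx₂ : x = e₂
  · subst hx₂
    rw [serConfig_apply_snd hne, Function.update_self]
  · rw [serConfig_apply_of_ne _ hx₁ hx₂, Function.update_of_ne hx₂]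

/-- `e₂` closed: `serConfig` closes `e₁`. -/
theorem serConfig_of_true_false {e₁ e₂ : E} (hne : e₁ ≠ e₂) {ρ : Config E} (h₂ : ρ e₂ = false) :
    serConfig e₁ e₂ ρ = Function.update ρ e₁ false := by
  funext x
  by_cases hx₁ : x = e₁
  · subst hx₁
    rw [serConfig_apply_fst, h₂, Bool.and_false, Function.update_self]
  by_cases hx₂ : x = e₂
  · subst hx₂
    rw [serConfig_apply_snd hne, Function.update_of_ne hne.symm, h₂]
  · rw [serConfig_apply_of_ne _ hx₁ hx₂, Function.update_of_ne hx₁]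

/-- `e₁` closed: `serConfig` closes `e₂`. -/
theorem serConfig_of_false {e₁ e₂ : E} (hne : e₁ ≠ e₂) {ρ : Config E} (h₁ : ρ e₁ = false) :
    serConfig e₁ e₂ ρ = Function.update ρ e₂ false := by
  funext x
  by_cases hx₁ : x = e₁
  · subst hx₁
    rw [serConfig_apply_fst, h₁, Function.update_of_ne hne, h₁]
    rfl
  by_cases hx₂ : x = e₂
  · subst hx₂
    rw [serConfig_apply_snd hne, Function.update_self]
  · rw [serConfig_apply_of_ne _ hx₁ hx₂, Function.update_of_ne hx₂]

end Compl

section Cube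

variable {E : Type*} [Fintype E] [DecidableEq E] {ι : Type*}

/-- The ORDERED class sum of `K` under the row map `c` on the full cube. -/
noncomputable def cubeSum (K : ι → ι → ℝ) (c : Config E → ι) : ℝ := ∑ ρ : Config E, K (c ρ) (c ρᶜ)

/-- The class sum with `e'` DELETED (closed in both copies). -/
noncomputable def cubeSumDel (K : ι → ι → ℝ) (c : Config E → ι) (e' : E) : ℝ :=
  ∑ ρ : Config E, if ρ e' = false then K (c ρ) (c (Function.update ρᶜ e' false)) else 0

/-- The class sum with `e'` deleted and `e` CONTRACTED (open in both copies). -/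
noncomputable def cubeSumDelCon (K : ι → ι → ℝ) (c : Config E → ι) (e' e : E) : ℝ :=
  ∑ ρ : Config E, if ρ e' = false ∧ ρ e = true then
    K (c ρ) (c (Function.update (Function.update ρᶜ e' false) e true)) else 0

/-- The class sum with `e₁` and `e₂` deleted. -/
noncomputable def cubeSumDel2 (K : ι → ι → ℝ) (c : Config E → ι) (e₁ e₂ : E) : ℝ :=
  ∑ ρ : Config E, if ρ e₁ = false ∧ ρ e₂ = false then
    K (c ρ) (c (Function.update (Function.update ρᶜ e₁ false) e₂ false)) else 0

/-- Transport of a filtered sum along a bijection between the filters. -/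
theorem sum_ite_bij (P Q : Config E → Prop) [DecidablePred P] [DecidablePred Q]
    (f g : Config E → ℝ) (i j : Config E → Config E) (hi : ∀ ρ, P ρ → Q (i ρ))
    (hj : ∀ ρ, Q ρ → P (j ρ)) (hji : ∀ ρ, P ρ → j (i ρ) = ρ) (hij : ∀ ρ, Q ρ → i (j ρ) = ρ)
    (hfg : ∀ ρ, P ρ → f ρ = g (i ρ)) :
    (∑ ρ : Config E, if P ρ then f ρ else 0) = ∑ ρ : Config E, if Q ρ then g ρ else 0 := by
  rw [← Finset.sum_filter, ← Finset.sum_filter]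
  refine Finset.sum_nbij' i j ?_ ?_ ?_ ?_ ?_
  · intro ρ hρ
    simp only [Finset.mem_filter, Finset.mem_univ, true_and] at hρ ⊢
    exact hi ρ hρ
  · intro ρ hρ
    simp only [Finset.mem_filter, Finset.mem_univ, true_and] at hρ ⊢
    exact hj ρ hρ
  · intro ρ hρ
    simp only [Finset.mem_filter, Finset.mem_univ, true_and] at hρ
    exact hji ρ hρ
  · intro ρ hρ
    simp only [Finset.mem_filter, Finset.mem_univ, true_and] at hρ
    exact hij ρ hρ
  · intro ρ hρ
    simp only [Finset.mem_filter, Finset.mem_univ, true_and] at hρ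
    exact hfg ρ hρ

/-- A sum over the cube split by the states of two edges. -/
theorem sum_split_two (f : Config E → ℝ) (e e' : E) :
    ∑ ρ : Config E, f ρ =
      (∑ ρ : Config E, if ρ e = false ∧ ρ e' = false then f ρ else 0) +
      (∑ ρ : Config E, if ρ e = true ∧ ρ e' = true then f ρ else 0) +
      (∑ ρ : Config E, if ρ e = true ∧ ρ e' = false then f ρ else 0) +
      (∑ ρ : Config E, if ρ e = false ∧ ρ e' = true then f ρ else 0) := by
  simp only [← Finset.sum_add_distrib]
  refine Finset.sum_congr rfl fun ρ _ => ?_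
  cases ρ e <;> cases ρ e' <;> simp

/-- **The parallel identity**: for a row map that does not see `e'` when `e` is open and does not
see `e` when `e'` is open, `CS = CS(G − e') + 2·CS(G/e − e')`. -/
theorem cubeSum_parallel (K : ι → ι → ℝ) (c : Config E → ι) {e e' : E} (hne : e ≠ e')
    (H1 : ∀ (ω : Config E) (b : Bool), ω e = true → c (Function.update ω e' b) = c ω)
    (H2 : ∀ (ω : Config E) (b : Bool), ω e' = true → c (Function.update ω e b) = c ω) :
    cubeSum K c = cubeSumDel K c e' + 2 * cubeSumDelCon K c e' e := by
  unfold cubeSum cubeSumDel cubeSumDelCon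
  rw [sum_split_two (fun ρ => K (c ρ) (c ρᶜ)) e e']
  -- (0,0): the complement has both open, `e'` is redundant
  have h00 : (∑ ρ : Config E, if ρ e = false ∧ ρ e' = false then K (c ρ) (c ρᶜ) else 0) =
      ∑ ρ : Config E, if ρ e = false ∧ ρ e' = false then
        K (c ρ) (c (Function.update ρᶜ e' false)) else 0 := by
    refine Finset.sum_congr rfl fun ρ _ => ?_
    split_ifs with h
    · rw [H1 ρᶜ false (compl_apply_of_eq_false h.1)]
    · rfl
  -- (1,1): close `e'` in the first copy
  have h11 : (∑ ρ : Config E, if ρ e = true ∧ ρ e' = true then K (c ρ) (c ρᶜ) else 0) =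
      ∑ ρ : Config E, if ρ e = true ∧ ρ e' = false then
        K (c ρ) (c (Function.update ρᶜ e' false)) else 0 := by
    refine sum_ite_bij _ _ _ _ (fun ρ => Function.update ρ e' false)
      (fun ρ => Function.update ρ e' true) ?_ ?_ ?_ ?_ ?_
    · intro ρ h
      exact ⟨by rw [Function.update_of_ne hne]; exact h.1, Function.update_self _ _ _⟩
    · intro ρ h
      exact ⟨by rw [Function.update_of_ne hne]; exact h.1, Function.update_self _ _ _⟩
    · intro ρ h
      rw [Function.update_idem, update_eq_self_of_eq h.2]
    · intro ρ h
      rw [Function.update_idem, update_eq_self_of_eq h.2]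
    · intro ρ h
      rw [H1 ρ false h.1, compl_update, Function.update_idem,
        update_eq_self_of_eq (compl_apply_of_eq_true h.2)]
  -- (1,0): the complement has `e'` open and `e` closed: open `e`, then close `e'`
  have h10 : (∑ ρ : Config E, if ρ e = true ∧ ρ e' = false then K (c ρ) (c ρᶜ) else 0) =
      ∑ ρ : Config E, if ρ e' = false ∧ ρ e = true then
        K (c ρ) (c (Function.update (Function.update ρᶜ e' false) e true)) else 0 := by
    refine Finset.sum_congr rfl fun ρ _ => ?_
    by_cases h : ρ e = true ∧ ρ e' = false
    · rw [if_pos h, if_pos ⟨h.2, h.1⟩, Function.update_comm hne.symm,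
        H1 _ false (Function.update_self _ _ _), H2 ρᶜ true (compl_apply_of_eq_false h.2)]
    · rw [if_neg h, if_neg fun h' => h ⟨h'.2, h'.1⟩]
  -- (0,1): swap the two bits
  have h01 : (∑ ρ : Config E, if ρ e = false ∧ ρ e' = true then K (c ρ) (c ρᶜ) else 0) =
      ∑ ρ : Config E, if ρ e' = false ∧ ρ e = true then
        K (c ρ) (c (Function.update (Function.update ρᶜ e' false) e true)) else 0 := by
    refine sum_ite_bij _ _ _ _ (fun ρ => Function.update (Function.update ρ e' false) e true)
      (fun ρ => Function.update (Function.update ρ e false) e' true) ?_ ?_ ?_ ?_ ?_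
    · intro ρ h
      refine ⟨?_, Function.update_self _ _ _⟩
      rw [Function.update_of_ne hne.symm, Function.update_self]
    · intro ρ h
      refine ⟨?_, Function.update_self _ _ _⟩
      rw [Function.update_of_ne hne, Function.update_self]
    · intro ρ h
      rw [Function.update_idem, Function.update_comm (β := fun _ => Bool) hne.symm false false,
        Function.update_idem, update_eq_self_of_eq h.1, update_eq_self_of_eq h.2]
    · intro ρ h
      rw [Function.update_idem, Function.update_comm (β := fun _ => Bool) hne false false,
        Function.update_idem, update_eq_self_of_eq h.1, update_eq_self_of_eq h.2]
    · intro ρ h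
      congr 1
      · rw [Function.update_comm (β := fun _ => Bool) hne.symm false true,
          H1 _ false (Function.update_self _ _ _), H2 ρ true h.2]
      · rw [compl_update, compl_update]
        simp only [Bool.not_true, Bool.not_false]
        rw [Function.update_comm (β := fun _ => Bool) hne.symm false true, Function.update_idem,
          Function.update_comm (β := fun _ => Bool) hne true false, Function.update_idem,
          update_eq_self_of_eq (compl_apply_of_eq_true h.2),
          update_eq_self_of_eq (compl_apply_of_eq_false h.1)]
  rw [h00, h11, h10, h01, ← Finset.sum_add_distrib]
  have hdel : (∑ ρ : Config E, ((if ρ e = false ∧ ρ e' = false then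
      K (c ρ) (c (Function.update ρᶜ e' false)) else 0) +
      if ρ e = true ∧ ρ e' = false then K (c ρ) (c (Function.update ρᶜ e' false)) else 0)) =
      ∑ ρ : Config E, if ρ e' = false then K (c ρ) (c (Function.update ρᶜ e' false)) else 0 := by
    refine Finset.sum_congr rfl fun ρ _ => ?_
    cases ρ e <;> cases ρ e' <;> simp
  rw [hdel]
  ring

/-- **The subdivision identity**: for row maps related by `c ρ = c' (serConfig e₁ e₂ ρ)`
(`Series.lean`: `c` on the subdivided graph, `c'` on the graph with the edge `e₁ = y–z`),
`CS(G sub e) = CS(G' − e₂) + 2·CS(G' − e₁ − e₂)`. -/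
theorem cubeSum_series (K : ι → ι → ℝ) (c c' : Config E → ι) {e₁ e₂ : E} (hne : e₁ ≠ e₂)
    (hc : ∀ ρ, c ρ = c' (serConfig e₁ e₂ ρ)) :
    cubeSum K c = cubeSumDel K c' e₂ + 2 * cubeSumDel2 K c' e₁ e₂ := by
  unfold cubeSum cubeSumDel cubeSumDel2
  simp only [hc]
  rw [sum_split_two (fun ρ => K (c' (serConfig e₁ e₂ ρ)) (c' (serConfig e₁ e₂ ρᶜ))) e₁ e₂]
  -- (0,0): nothing moves in the first copy; the complement has both open: `e₂` closes
  have h00 : (∑ ρ : Config E, if ρ e₁ = false ∧ ρ e₂ = false then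
      K (c' (serConfig e₁ e₂ ρ)) (c' (serConfig e₁ e₂ ρᶜ)) else 0) =
      ∑ ρ : Config E, if ρ e₁ = false ∧ ρ e₂ = false then
        K (c' ρ) (c' (Function.update ρᶜ e₂ false)) else 0 := by
    refine Finset.sum_congr rfl fun ρ _ => ?_
    split_ifs with h
    · rw [serConfig_eq_self hne ρ h.1 h.2,
        serConfig_of_true_true hne (compl_apply_of_eq_false h.1) (compl_apply_of_eq_false h.2)]
    · rfl
  -- (1,1): close `e₂` in the first copy
  have h11 : (∑ ρ : Config E, if ρ e₁ = true ∧ ρ e₂ = true then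
      K (c' (serConfig e₁ e₂ ρ)) (c' (serConfig e₁ e₂ ρᶜ)) else 0) =
      ∑ ρ : Config E, if ρ e₁ = true ∧ ρ e₂ = false then
        K (c' ρ) (c' (Function.update ρᶜ e₂ false)) else 0 := by
    refine sum_ite_bij _ _ _ _ (fun ρ => Function.update ρ e₂ false)
      (fun ρ => Function.update ρ e₂ true) ?_ ?_ ?_ ?_ ?_
    · intro ρ h
      exact ⟨by rw [Function.update_of_ne hne]; exact h.1, Function.update_self _ _ _⟩
    · intro ρ h
      exact ⟨by rw [Function.update_of_ne hne]; exact h.1, Function.update_self _ _ _⟩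
    · intro ρ h
      rw [Function.update_idem, update_eq_self_of_eq h.2]
    · intro ρ h
      rw [Function.update_idem, update_eq_self_of_eq h.2]
    · intro ρ h
      rw [serConfig_of_true_true hne h.1 h.2,
        serConfig_eq_self hne ρᶜ (compl_apply_of_eq_true h.1) (compl_apply_of_eq_true h.2),
        compl_update, Function.update_idem, update_eq_self_of_eq (compl_apply_of_eq_true h.2)]
  -- (1,0): `e₁` closes in the first copy; the complement `(0,1)` reduces to both closed
  have h10 : (∑ ρ : Config E, if ρ e₁ = true ∧ ρ e₂ = false then
      K (c' (serConfig e₁ e₂ ρ)) (c' (serConfig e₁ e₂ ρᶜ)) else 0) =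
      ∑ ρ : Config E, if ρ e₁ = false ∧ ρ e₂ = false then
        K (c' ρ) (c' (Function.update (Function.update ρᶜ e₁ false) e₂ false)) else 0 := by
    refine sum_ite_bij _ _ _ _ (fun ρ => Function.update ρ e₁ false)
      (fun ρ => Function.update ρ e₁ true) ?_ ?_ ?_ ?_ ?_
    · intro ρ h
      exact ⟨Function.update_self _ _ _, by rw [Function.update_of_ne hne.symm]; exact h.2⟩
    · intro ρ h
      exact ⟨Function.update_self _ _ _, by rw [Function.update_of_ne hne.symm]; exact h.2⟩
    · intro ρ h
      rw [Function.update_idem, update_eq_self_of_eq h.1]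
    · intro ρ h
      rw [Function.update_idem, update_eq_self_of_eq h.1]
    · intro ρ h
      rw [serConfig_of_true_false hne h.2, serConfig_of_false hne (compl_apply_of_eq_true h.1),
        compl_update, Function.update_idem]
      congr 2
      rw [update_eq_self_of_eq (compl_apply_of_eq_true h.1)]
  -- (0,1): `e₂` closes in the first copy; the complement `(1,0)` reduces to both closed
  have h01 : (∑ ρ : Config E, if ρ e₁ = false ∧ ρ e₂ = true then
      K (c' (serConfig e₁ e₂ ρ)) (c' (serConfig e₁ e₂ ρᶜ)) else 0) =
      ∑ ρ : Config E, if ρ e₁ = false ∧ ρ e₂ = false then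
        K (c' ρ) (c' (Function.update (Function.update ρᶜ e₁ false) e₂ false)) else 0 := by
    refine sum_ite_bij _ _ _ _ (fun ρ => Function.update ρ e₂ false)
      (fun ρ => Function.update ρ e₂ true) ?_ ?_ ?_ ?_ ?_
    · intro ρ h
      exact ⟨by rw [Function.update_of_ne hne]; exact h.1, Function.update_self _ _ _⟩
    · intro ρ h
      exact ⟨by rw [Function.update_of_ne hne]; exact h.1, Function.update_self _ _ _⟩
    · intro ρ h
      rw [Function.update_idem, update_eq_self_of_eq h.2]
    · intro ρ h
      rw [Function.update_idem, update_eq_self_of_eq h.2]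
    · intro ρ h
      rw [serConfig_of_false hne h.1, serConfig_of_true_false hne (compl_apply_of_eq_true h.2),
        compl_update]
      simp only [Bool.not_false]
      congr 2
      rw [Function.update_comm (β := fun _ => Bool) hne false false, Function.update_idem,
        update_eq_self_of_eq (compl_apply_of_eq_true h.2)]
  rw [h00, h11, h10, h01, ← Finset.sum_add_distrib]
  have hdel : (∑ ρ : Config E, ((if ρ e₁ = false ∧ ρ e₂ = false then
      K (c' ρ) (c' (Function.update ρᶜ e₂ false)) else 0) +
      if ρ e₁ = true ∧ ρ e₂ = false then K (c' ρ) (c' (Function.update ρᶜ e₂ false)) else 0)) =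
      ∑ ρ : Config E, if ρ e₂ = false then K (c' ρ) (c' (Function.update ρᶜ e₂ false)) else 0 := by
    refine Finset.sum_congr rfl fun ρ _ => ?_
    cases ρ e₁ <;> cases ρ e₂ <;> simp
  rw [hdel]
  ring

end Cube

/-! ### The C-011 instances -/

namespace MultiGraph

variable {V E : Type*} (G : MultiGraph V E) [DecidableEq E]

/-- The row map does not see a parallel edge when its twin is open. -/
theorem row4_markedPartition_update_of_parallel {e e' : E} (hne : e ≠ e') (hpar : G.Parallel e e')
    (m : Fin 4 → V) (ω : Config E) (b : Bool) (h : ω e = true) :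
    row4 (G.markedPartition (Function.update ω e' b) m) = row4 (G.markedPartition ω m) := by
  congr 1
  ext i j
  exact G.conn_update_iff_of_parallel hne.symm hpar.symm h b (m i) (m j)

/-- The row map of the subdivided graph is the row map of the reduced graph at `serConfig`. -/
theorem IsSeries.row4_markedPartition {e₁ e₂ : E} {x y z : V} (hs : G.IsSeries e₁ e₂ x y z)
    {m : Fin 4 → V} (hm : ∀ i, m i ≠ x) (ρ : Config E) :
    row4 (G.markedPartition ρ m) =
      row4 ((G.seriesGraph e₁ y z).markedPartition (serConfig e₁ e₂ ρ) m) := by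
  congr 1
  ext i j
  exact hs.conn_iff ρ (hm i) (hm j)

variable [Fintype E]

/-- p1's `CS(G)`: the ordered full-cube class sum of the C-011 kernel (`= g − b − n`). -/
noncomputable def cubeSumC011 (m : Fin 4 → V) : ℝ :=
  cubeSum phiPlusKernel fun ρ => row4 (G.markedPartition ρ m)

/-- `CS(G) = g − b − n_xR`. -/
theorem cubeSumC011_eq (m : Fin 4 → V) :
    G.cubeSumC011 m =
      (goodCount fun ρ : Config E => row4 (G.markedPartition ρ m) : ℝ) -
        badCount (fun ρ : Config E => row4 (G.markedPartition ρ m)) -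
        liabilityCount fun ρ : Config E => row4 (G.markedPartition ρ m) :=
  sum_phiPlusKernel_compl _

/-- **`CS(G + e′) = CS(G − e′) + 2·CS(G/e − e′)`** for a parallel pair `e ∥ e′`. -/
theorem cubeSumC011_parallel {e e' : E} (hne : e ≠ e') (hpar : G.Parallel e e') (m : Fin 4 → V) :
    G.cubeSumC011 m =
      cubeSumDel phiPlusKernel (fun ρ => row4 (G.markedPartition ρ m)) e' +
        2 * cubeSumDelCon phiPlusKernel (fun ρ => row4 (G.markedPartition ρ m)) e' e :=
  cubeSum_parallel _ _ hne
    (fun ω b h => G.row4_markedPartition_update_of_parallel hne hpar m ω b h)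
    (fun ω b h => G.row4_markedPartition_update_of_parallel hne.symm hpar.symm m ω b h)

/-- **`CS(G sub e) = CS(G′ − e₂) + 2·CS(G′ − e₁ − e₂)`** for a series pair at an unmarked vertex
(`G′` = the graph with `e₁ = y–z`; `e₂` is deleted in it anyway). -/
theorem IsSeries.cubeSumC011 {e₁ e₂ : E} {x y z : V} (hs : G.IsSeries e₁ e₂ x y z)
    {m : Fin 4 → V} (hm : ∀ i, m i ≠ x) :
    G.cubeSumC011 m =
      cubeSumDel phiPlusKernel (fun ρ => row4 ((G.seriesGraph e₁ y z).markedPartition ρ m)) e₂ +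
        2 * cubeSumDel2 phiPlusKernel
          (fun ρ => row4 ((G.seriesGraph e₁ y z).markedPartition ρ m)) e₁ e₂ :=
  cubeSum_series _ _ _ hs.ne (hs.row4_markedPartition G hm)

end MultiGraph

end PercRepro
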